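import Mathlib.Algebra.Order.Archimedean.Real.Basic
import Mathlib.Algebra.Ring.Subring.Basic
import Mathlib.Tactic.FieldSimp
import Mathlib.Tactic.GCongr
import Mathlib.Tactic.Linarith
import Mathlib.Tactic.NormNum
import Mathlib.Tactic.Positivity
import Mathlib.Tactic.Ring
import Literature.Computability.Complexity.ComputableReal
import HarnessLib

/-!
# Discharges for `Literature.Computability.Complexity.ComputableReal`

Proofs of named facts stated in `Literature.Computability.Complexity.ComputableReal`, kept in their
own sibling file so that the statement file (which has importers) is not rewritten. This file
introduces no definitions.

## Every rational number is a computable real — discharge of `IsComputableReal.ratCast`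

Mathematical content (Weihrauch, *Computable Analysis* (2000), §4.2, the remark immediately after
the proof of Lemma 4.2.1): "Every rational number `a` is computable (if `ν_ℚ(u) = a`, define
`g(n) := u` for all `n` in Lemma 4.2.1.3)."  Lemma 4.2.1.3 characterises the computable reals `x`
by a computable `g` with `|x - ν_ℚ g(n)| ≤ 2⁻ⁿ` for all `n`, which is exactly the vendored
`IsComputableReal` (a computable fast Cauchy name `ℕ → ℚ`). So the constant sequence `n ↦ q` is a
computable (`Computable.const`) fast Cauchy name of `q`, since `|q - q| = 0 ≤ 2⁻ⁿ`
(`IsComputableReal.ratCast_holds`).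

## Every elementary real is computable — discharge of `IsElementaryReal.isComputableReal`

Source: K. Tent, M. Ziegler, *Computable functions of reals*, Münster J. Math. **3** (2010), 43–66,
§2 "Good classes of functions" (pp. 43–45). The elementary functions are the third Grzegorczyk
class `𝓔³` (pp. 43–44), so they are primitive recursive (`ElementaryRec.primrec_holds`, Rose 1984,
in the statement file) and hence computable; `ℚ` is a (lower elementary) retract of `ℤ × ℕ` via the
lowest-terms representation `ι(r) = (z, n)` (p. 44); and (Def. 2.4, p. 45) `x` is an `F`-real if
`|x - a(k)| < 1/k` for some `F`-function `a : ℕ → ℚ`. The vendored `IsElementaryReal` is the case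
`F` = elementary in the three-sequence form `a(k) = (a k - b k)/(c k + 1)` with error `≤ 1/(k+1)`;
the vendored `IsComputableReal` (Weihrauch 2000, Def. 4.1.13) asks for a *computable* `f : ℕ → ℚ`
with error `≤ 2⁻ᵏ`. "Elementary reals are computable" is thus the remark `𝓔³ ⊆` recursive
functions of §2 combined with Def. 2.4, after passing to the subsequence `n = 2^k`
(`1/(2^k + 1) ≤ 2⁻ᵏ`). The statement is proved as vendored (`IsElementaryReal.isComputableReal_holds`).

The Lean work is the coding of rationals. Mathlib's `Primcodable ℚ` is `Primcodable.ofDenumerable ℚ`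
over `Rat.instDenumerable = Denumerable.ofEncodableOfInfinite ℚ`: the code of `q` is the *rank* of
the numerator–denominator code `Nat.pair (Equiv.intEquivNat q.num) q.den` (which is Mathlib's
`Rat.instEncodable` code, and Tent–Ziegler's retract `ι`) inside the range of that code
(`rat_encode_eq_rank`, by `rfl`). Hence a map into `ℚ` is primitive recursive as soon as its
numerator–denominator code is (`primrec_rat_of_numDenCode`): the range of the code is a primitive
recursive set (`mem_range_ratNumDenCode_primrec`, from an auxiliary `Primcodable` structure on `ℚ`
transported from the lowest-terms subtype of `ℤ × ℕ`, whose code *is* the numerator–denominator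
code), so the rank is a bounded count of a primitive recursive predicate. Finally the code of
`(a - b)/(c + 1)` is an explicit `gcd` expression in `a b c : ℕ` (`ratNumDenCode_mkRat_sub`), and
`Nat.gcd` is primitive recursive (`nat_gcd_primrec`, via `Nat.findGreatest`).

## Computable reals are closed under negation — discharge of `IsComputableReal.neg`

Source: Weihrauch, *Computable Analysis* (2000), Thm. 4.3.2.3 ("the following real functions are
computable: … 3. `x ↦ -x`"), whose printed proof is: there is a computable word function `f` with
`-ν_ℚ(w) = ν_ℚ f(w)`, and the machine mapping a Cauchy name `ι(u₀)ι(u₁)…` of `x` to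
`ι(f(u₀))ι(f(u₁))…` outputs a name of `-x`. Combined with Lemma 4.2.1.3 (a real is computable iff it
has a computable `g` with `|x - ν_ℚ g(n)| ≤ 2⁻ⁿ`, the vendored `IsComputableReal`) and Thm. 2.1.13 /
Thm. 3.1.6 (computable functions map computable elements to computable elements), this is the
vendored closure statement, proved as stated (`IsComputableReal.neg_holds`): if `f` is a computable
fast Cauchy name of `x` then `n ↦ -f n` is one of `-x`, since `|-x - (-f n)| = |x - f n|`.

The Lean work is again the coding of rationals, now for a map *out of* `ℚ`: negation on `ℚ`
is primitive recursive for Mathlib's `Primcodable ℚ` (`rat_neg_primrec`). The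
numerator–denominator code `q ↦ Nat.pair (Equiv.intEquivNat q.num) q.den` is primitive recursive
on `ℚ` (`ratNumDenCode_primrec`, by `Primrec.of_graph`: its graph is "`m` is in the range of the
code and the rank of `m` is the Mathlib code of `q`", and it is bounded by `Nat.pair (2c) 1`, `c`
the Mathlib code of `q`, because the codes of `0, 1, 2, …` are strictly increasing,
`self_le_rat_encode_natCast`); hence `Rat.num` and `Rat.den` are primitive recursive
(`rat_num_primrec`, `rat_den_primrec`), negation on `ℤ` is an explicit parity formula on
`Equiv.intEquivNat` codes (`int_neg_primrec`), and `primrec_rat_of_numDenCode` reassembles `-q`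
from `(-q.num, q.den)`.

## Computable reals via a computable modulus — discharge of `isComputableReal_iff_modulus`

Source: Weihrauch, *Computable Analysis* (2000), §4.2 "Computable Real Numbers", Lemma 4.2.1:
"For any `x ∈ ℝ` the following properties are equivalent: … 3. There is a computable function
`g : ℕ → Σ*` such that `|x - ν_ℚ g(n)| ≤ 2⁻ⁿ` for all `n ∈ ℕ`. … 5. [PER89] There are computable
functions `s, a, b, e : ℕ → ℕ` with `|x - (-1)^{s(k)} a(k)/b(k)| ≤ 2^{-N}`, if `k ≥ e(N)`, for all
`k, N ∈ ℕ`."  The printed proof of `3 ⟹ 5` is "Define `e(N) := N`", and `5 ⟹ 4 ⟹ 1 ⟹ 3` passes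
to the subsequence `a ∘ e`, `b ∘ e` along a computable reindexing.  Together with Def. 4.2.2
(modulus of convergence) and the remark following it ("if `e'` is a function with
`|x - x_i| ≤ 2⁻ⁿ` for `i ≥ e'(n)`, then … computable, if `e'` is computable"; "the limit of any
computable sequence of rational numbers with computable modulus of convergence is a computable real
number") this is the vendored `isComputableReal_iff_modulus`, which phrases item 5 with a computable
rational sequence `f : ℕ → ℚ` in place of the sign/numerator/denominator triple and with the error
scale `1/(n+1)` in place of `2^{-N}` (the two scales are computably interreducible: `2⁻ⁿ ≤ 1/(n+1)`
and `1/(2ⁿ+1) ≤ 2⁻ⁿ`).  Historically the modulus form (a recursive sequence of rationals with a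
recursive modulus of convergence) is the notion of *recursive real number* of Rice (1954), to
which the statement file attributes the fact; the equivalence of the classical effective
representations (Cauchy sequences, Dedekind cuts, expansions) goes back to Robinson, Myhill and
Rice (see Chen–Su–Zheng, ENTCS 167 (2007), §1).  Lean proof
(`isComputableReal_iff_modulus_holds`), following the printed one:
(⟹) keep the fast Cauchy name `f` and take the modulus `m := id` (`Computable.id`), since for
`k ≥ n`, `|x - f k| ≤ 2⁻ᵏ ≤ 2⁻ⁿ ≤ 1/(n+1)`; (⟸) reindex along the computable map `n ↦ m (2ⁿ)`
(`Nat.Primrec.pow`): `n ↦ f (m (2ⁿ))` is computable as a composition and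
`|x - f (m (2ⁿ))| ≤ 1/(2ⁿ+1) ≤ 2⁻ⁿ`.

## Computable reals form a ring — discharges of `IsComputableReal.add` and `IsComputableReal.mul`

Source: Weihrauch, *Computable Analysis* (2000), Thm. 4.3.2 ("the following real functions are
computable: … 4. `(x, y) ↦ x + y`, 5. `(x, y) ↦ x · y`"), combined as before with Lemma 4.2.1.3 and
Thm. 3.1.6 (computable functions preserve computable points); Cor. 4.3.4 records that the computable
reals form a (real closed) field. Lean proofs (`IsComputableReal.add_holds`,
`IsComputableReal.mul_holds`): termwise sum `n ↦ f (n+1) + g (n+1)` (error `2 · 2⁻⁽ⁿ⁺¹⁾ = 2⁻ⁿ`) and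
shifted termwise product `n ↦ f (n+s) g (n+s)` with `|x| + |y| + 1 ≤ 2^s`
(error `≤ (|x| + |y| + 1) 2⁻⁽ⁿ⁺ˢ⁾ ≤ 2⁻ⁿ`). The Lean work is that `+`, `*`, `-`, `≤`, `<` on `ℚ` are
primitive recursive for Mathlib's `Primcodable ℚ` (`rat_add_primrec`, `rat_mul_primrec`,
`rat_sub_primrec`, `rat_le_primrecRel`, `rat_lt_primrecRel`): by `Rat.add_def'` / `Rat.mul_def'`
and the positive/negative-part split `z = z⁺ - z⁻` of numerators (`Int.toNat` is primitive
recursive, `int_toNat_primrec`), `a + b` and `a * b` are `mkRat (A - B) (C + 1)` with `A B C : ℕ`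
primitive recursive in the numerator–denominator data, so `ratNumDenCode_mkRat_sub_primrec` applies.
Consequences: `IsComputableReal.sub`, `exists_subring_coe_eq_computableReals`,
`subringClosure_subset_computableReals`, and the **two-sided approximation principle**
`IsComputableReal.of_twoSided` (computable rational lower/upper bounds whose gap becomes `≤ 2⁻ⁿ`
for some index give a computable real, the index being found by `Nat.rfind`; Weihrauch 2000,
Lemma 4.2.1).

## References

* K. Weihrauch, *Computable Analysis: An Introduction*, Texts in Theoretical Computer Science,
  Springer 2000, doi:10.1007/978-3-642-56999-9, §4.2, remark after Lemma 4.2.1; Lemma 4.2.1.3;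
  §4.3, Thm. 4.3.2.3; Thm. 2.1.13 and Thm. 3.1.6.
  [cite: Weihrauch2000, §4.2, remark after Lemma 4.2.1] [cite: Weihrauch2000, Thm. 4.3.2.3]
  [cite: Weihrauch2000, Lemma 4.2.1 (3 ⇔ 5) and Def. 4.2.2]
* H. G. Rice, *Recursive real numbers*, Proc. Amer. Math. Soc. 5 (1954), 784–791,
  doi:10.1090/S0002-9939-1954-0063328-4 (the definition of a recursive real number by a recursive
  sequence of rationals with a recursive modulus of convergence). [cite: Rice1954]
* K. Tent, M. Ziegler, *Computable functions of reals*, Münster J. Math. 3 (2010), 43–66,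
  urn:nbn:de:hbz:6-16409482014, §2 (pp. 43–45), Def. 2.4. [cite: TentZiegler2010, §2 Def. 2.4]
-/

namespace Literature.Computability.Complexity

/-- **Discharge of `IsComputableReal.ratCast`.** Every rational number `q` is a computable real
(Weihrauch, *Computable Analysis* (2000), §4.2, remark following Lemma 4.2.1). Proof, as printed
there: the constant sequence `n ↦ q` is computable (`Computable.const`) and is a fast Cauchy name of
`q`, since `|q - q| = 0 ≤ 2⁻ⁿ`. [cite: Weihrauch2000, §4.2, remark after Lemma 4.2.1] -/
theorem IsComputableReal.ratCast_holds : IsComputableReal.ratCast := by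
  intro q
  refine ⟨fun _ => q, Computable.const q, fun n => ?_⟩
  show |(q : ℝ) - q| ≤ (1 / 2 : ℝ) ^ n
  rw [sub_self, abs_zero]
  exact pow_nonneg (div_nonneg zero_le_one zero_le_two) n

/-! ### Discharge of `IsElementaryReal.isComputableReal` (Tent–Ziegler 2010, §2) -/

open Encodable

section RatCoding

/-! #### Coding rationals for Mathlib's `Primcodable ℚ` -/

/-- `Equiv.intEquivNat` sends `(m : ℤ)` to `2 * m`. [folklore] -/
theorem intEquivNat_natCast (m : ℕ) : Equiv.intEquivNat (m : ℤ) = 2 * m := rfl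

/-- `Equiv.intEquivNat` sends `Int.negSucc m` to `2 * m + 1`. [folklore] -/
theorem intEquivNat_negSucc (m : ℕ) : Equiv.intEquivNat (Int.negSucc m) = 2 * m + 1 := rfl

/-- `Int.natAbs` read off from the `Equiv.intEquivNat` code. [folklore] -/
theorem natAbs_intEquivNat_symm (i : ℕ) :
    (Equiv.intEquivNat.symm i).natAbs = cond i.bodd (i.div2 + 1) i.div2 := by
  simp [Equiv.intEquivNat, Equiv.intEquivNatSumNat]
  cases i.bodd <;> simp

/-- `Int.natAbs` is primitive recursive (for Mathlib's `Primcodable ℤ`, whose code is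
`Equiv.intEquivNat`). [folklore] -/
theorem int_natAbs_primrec : Primrec Int.natAbs := by
  have h1 : Primrec fun i : ℕ => cond i.bodd (i.div2 + 1) i.div2 :=
    Primrec.cond Primrec.nat_bodd (Primrec.succ.comp Primrec.nat_div2) Primrec.nat_div2
  refine (h1.comp Primrec.encode).of_eq fun z => ?_
  have : (encode z) = Equiv.intEquivNat z := rfl
  rw [← natAbs_intEquivNat_symm, this, Equiv.symm_apply_apply]

/-- Divisibility on `ℕ` is a primitive recursive relation. [folklore] -/
theorem nat_dvd_primrecRel : PrimrecRel (fun a b : ℕ => a ∣ b) := by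
  have h : PrimrecPred fun p : ℕ × ℕ => p.2 % p.1 = 0 :=
    Primrec.eq.comp (Primrec.nat_mod.comp Primrec.snd Primrec.fst) (Primrec.const 0)
  exact PrimrecPred.of_eq h fun p => (Nat.dvd_iff_mod_eq_zero).symm

/-- `Nat.gcd a b` is the greatest common divisor below `max a b` (bounded search form). [folklore] -/
theorem nat_gcd_eq_findGreatest (a b : ℕ) :
    Nat.findGreatest (fun k => k ∣ a ∧ k ∣ b) (max a b) = Nat.gcd a b := by
  rw [Nat.findGreatest_eq_iff]
  refine ⟨?_, fun _ => ⟨Nat.gcd_dvd_left a b, Nat.gcd_dvd_right a b⟩, ?_⟩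
  · rcases Nat.eq_zero_or_pos a with rfl | ha
    · simp
    · exact (Nat.gcd_le_left b ha).trans (le_max_left a b)
  · rintro n hlt hle ⟨h1, h2⟩
    have hn : n ∣ Nat.gcd a b := Nat.dvd_gcd h1 h2
    rcases Nat.eq_zero_or_pos (Nat.gcd a b) with h0 | hpos
    · obtain ⟨rfl, rfl⟩ := Nat.gcd_eq_zero_iff.1 h0
      omega
    · exact absurd (Nat.le_of_dvd hpos hn) (not_le.2 hlt)

/-- `Nat.gcd` is primitive recursive (as a bounded search, `Primrec.nat_findGreatest`). [folklore] -/
theorem nat_gcd_primrec : Primrec₂ Nat.gcd := by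
  have hrel : PrimrecRel fun (p : ℕ × ℕ) (k : ℕ) => k ∣ p.1 ∧ k ∣ p.2 :=
    (nat_dvd_primrecRel.comp Primrec.snd (Primrec.fst.comp Primrec.fst)).and
      (nat_dvd_primrecRel.comp Primrec.snd (Primrec.snd.comp Primrec.fst))
  have h := Primrec.nat_findGreatest (Primrec.nat_max.comp Primrec.fst Primrec.snd) hrel
  exact h.of_eq fun p => nat_gcd_eq_findGreatest p.1 p.2

/-- The lowest-terms condition on `ℤ × ℕ` (positive denominator coprime to the numerator) is a
primitive recursive predicate. [folklore] -/
theorem rat_lowestTerms_primrecPred :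
    PrimrecPred fun p : ℤ × ℕ => 0 < p.2 ∧ p.1.natAbs.Coprime p.2 :=
  (Primrec.nat_lt.comp (Primrec.const 0) Primrec.snd).and
    (Primrec.eq.comp (nat_gcd_primrec.comp (int_natAbs_primrec.comp Primrec.fst) Primrec.snd)
      (Primrec.const 1))

/-- Mathlib's `Rat.instEncodable` code of a rational is its numerator–denominator code
`Nat.pair (Equiv.intEquivNat q.num) q.den` (definitionally); this is the retract `ι : ℚ → ℤ × ℕ`,
`ι(z/n) = (z, n)` in lowest terms, of Tent–Ziegler 2010, §2 (p. 44), followed by Mathlib's codes of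
`ℤ` and of pairs. [cite: TentZiegler2010, §2 p. 44] -/
theorem rat_instEncodable_encode_eq (q : ℚ) :
    @encode ℚ Rat.instEncodable q = Nat.pair (Equiv.intEquivNat q.num) q.den := rfl

/-- Being the numerator–denominator code of some rational is a primitive recursive predicate.
Proof: transport a `Primcodable` structure to `ℚ` from the lowest-terms subtype of `ℤ × ℕ`
(`Primcodable.subtype`, `Primcodable.ofEquiv`); its code is the numerator–denominator code
(definitionally), so `Primcodable.mem_range_encode` applies. The transported structure is a local
term of this proof only, not an instance. [folklore] -/
theorem mem_range_ratNumDenCode_primrec :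
    PrimrecPred fun n => n ∈ Set.range (@encode ℚ Rat.instEncodable) := by
  let e : ℚ ≃ {p : ℤ × ℕ // 0 < p.2 ∧ p.1.natAbs.Coprime p.2} :=
    { toFun := fun q => ⟨(q.num, q.den), q.den_pos, q.reduced⟩
      invFun := fun p => ⟨p.1.1, p.1.2, Nat.pos_iff_ne_zero.1 p.2.1, p.2.2⟩
      left_inv := fun _ => rfl
      right_inv := fun _ => rfl }
  let P : Primcodable ℚ := @Primcodable.ofEquiv _ ℚ (Primcodable.subtype rat_lowestTerms_primrecPred) e
  have hP : @encode ℚ P.toEncodable = @encode ℚ Rat.instEncodable := rfl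
  have h := @Primcodable.mem_range_encode ℚ P
  rw [hP] at h
  exact h

/-- Mathlib's code of a rational for the instance `Primcodable ℚ` (which is
`Primcodable.ofDenumerable ℚ` over `Rat.instDenumerable = Denumerable.ofEncodableOfInfinite ℚ`) is
the rank of its numerator–denominator code inside the range of that code, membership in the range
being decided by `Encodable.decidableRangeEncode` (all definitionally). [folklore] -/
theorem rat_encode_eq_rank (q : ℚ) :
    @encode ℚ (Primcodable.ofDenumerable ℚ).toEncodable q =
      (List.range (Nat.pair (Equiv.intEquivNat q.num) q.den)).countP fun y =>
        @decide (y ∈ Set.range (@encode ℚ Rat.instEncodable))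
          (@Encodable.decidableRangeEncode ℚ Rat.instEncodable y) := rfl

/-- A map into `ℚ` is primitive recursive (for Mathlib's `Primcodable ℚ`) as soon as its
numerator–denominator code is: by `rat_encode_eq_rank` the code of `f a` is a bounded count
(`List.countP` over `List.range`) of the primitive recursive predicate
`mem_range_ratNumDenCode_primrec` up to the numerator–denominator code of `f a`. [folklore] -/
theorem primrec_rat_of_numDenCode {α : Type*} [Primcodable α] {f : α → ℚ}
    (hf : Primrec fun a => Nat.pair (Equiv.intEquivNat (f a).num) (f a).den) : Primrec f := by
  letI := @Encodable.decidableRangeEncode ℚ Rat.instEncodable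
  have hrank : Primrec fun n : ℕ =>
      (List.range n).countP fun y => y ∈ Set.range (@encode ℚ Rat.instEncodable) := by
    refine (Primrec.list_length.comp
      ((Primrec.listFilter mem_range_ratNumDenCode_primrec).comp Primrec.list_range)).of_eq ?_
    intro n
    exact List.countP_eq_length_filter.symm
  exact Primrec.encode_iff.1 ((hrank.comp hf).of_eq fun a => (rat_encode_eq_rank (f a)).symm)

/-- The numerator–denominator code of the rational `(a - b) / (c + 1)` (`a b c : ℕ`) is an explicit
arithmetic (`gcd`) expression in `a`, `b`, `c`. [folklore] -/
theorem ratNumDenCode_mkRat_sub (a b c : ℕ) :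
    Nat.pair (Equiv.intEquivNat (mkRat ((a : ℤ) - b) (c + 1)).num) (mkRat ((a : ℤ) - b) (c + 1)).den =
      if b ≤ a then Nat.pair (2 * ((a - b) / (c + 1).gcd (a - b))) ((c + 1) / (c + 1).gcd (a - b))
      else Nat.pair (2 * ((b - a) / (c + 1).gcd (b - a)) - 1) ((c + 1) / (c + 1).gcd (b - a)) := by
  simp only [Rat.num_mkRat, Rat.den_mkRat, Nat.succ_ne_zero, if_false]
  by_cases h : b ≤ a
  · rw [if_pos h]
    have hz : (a : ℤ) - b = ((a - b : ℕ) : ℤ) := by push_cast [h]; ring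
    rw [hz, Int.natAbs_natCast, ← Int.natCast_div, intEquivNat_natCast]
  · rw [if_neg h]
    replace h : a < b := not_le.1 h
    have hz : (a : ℤ) - b = -((b - a : ℕ) : ℤ) := by push_cast [h.le]; ring
    rw [hz, Int.natAbs_neg, Int.natAbs_natCast]
    set g := (c + 1).gcd (b - a) with hg
    have hgd : g ∣ (b - a) := Nat.gcd_dvd_right _ _
    have hgpos : 0 < g := Nat.gcd_pos_of_pos_left _ (Nat.succ_pos c)
    have hm : 0 < (b - a) / g := Nat.div_pos (Nat.le_of_dvd (by omega) hgd) hgpos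
    rw [Int.neg_ediv_of_dvd (Int.natCast_dvd_natCast.2 hgd), ← Int.natCast_div]
    obtain ⟨m, hm'⟩ : ∃ m, (b - a) / g = m + 1 := ⟨(b - a) / g - 1, by omega⟩
    rw [hm', show -(((m + 1 : ℕ) : ℤ)) = Int.negSucc m from rfl, intEquivNat_negSucc,
      show 2 * (m + 1) - 1 = 2 * m + 1 by omega]

/-- The numerator–denominator code of `(a - b) / (c + 1)` is a primitive recursive function of
`(a, b, c) : ℕ × ℕ × ℕ` (by `ratNumDenCode_mkRat_sub` and `nat_gcd_primrec`). [folklore] -/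
theorem ratNumDenCode_mkRat_sub_primrec :
    Primrec fun p : ℕ × ℕ × ℕ =>
      Nat.pair (Equiv.intEquivNat (mkRat ((p.1 : ℤ) - p.2.1) (p.2.2 + 1)).num)
        (mkRat ((p.1 : ℤ) - p.2.1) (p.2.2 + 1)).den := by
  have ha : Primrec fun p : ℕ × ℕ × ℕ => p.1 := Primrec.fst
  have hb : Primrec fun p : ℕ × ℕ × ℕ => p.2.1 := Primrec.fst.comp Primrec.snd
  have hd : Primrec fun p : ℕ × ℕ × ℕ => p.2.2 + 1 :=
    Primrec.succ.comp (Primrec.snd.comp Primrec.snd)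
  have h1 : Primrec fun p : ℕ × ℕ × ℕ => p.1 - p.2.1 := Primrec.nat_sub.comp ha hb
  have h2 : Primrec fun p : ℕ × ℕ × ℕ => p.2.1 - p.1 := Primrec.nat_sub.comp hb ha
  have hg1 : Primrec fun p : ℕ × ℕ × ℕ => (p.2.2 + 1).gcd (p.1 - p.2.1) :=
    nat_gcd_primrec.comp hd h1
  have hg2 : Primrec fun p : ℕ × ℕ × ℕ => (p.2.2 + 1).gcd (p.2.1 - p.1) :=
    nat_gcd_primrec.comp hd h2
  have hF : Primrec fun p : ℕ × ℕ × ℕ =>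
      if p.2.1 ≤ p.1 then
        Nat.pair (2 * ((p.1 - p.2.1) / (p.2.2 + 1).gcd (p.1 - p.2.1)))
          ((p.2.2 + 1) / (p.2.2 + 1).gcd (p.1 - p.2.1))
      else
        Nat.pair (2 * ((p.2.1 - p.1) / (p.2.2 + 1).gcd (p.2.1 - p.1)) - 1)
          ((p.2.2 + 1) / (p.2.2 + 1).gcd (p.2.1 - p.1)) := by
    refine Primrec.ite (Primrec.nat_le.comp hb ha) ?_ ?_
    · exact Primrec₂.natPair.comp
        (Primrec.nat_mul.comp (Primrec.const 2) (Primrec.nat_div.comp h1 hg1))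
        (Primrec.nat_div.comp hd hg1)
    · exact Primrec₂.natPair.comp
        (Primrec.nat_sub.comp
          (Primrec.nat_mul.comp (Primrec.const 2) (Primrec.nat_div.comp h2 hg2)) (Primrec.const 1))
        (Primrec.nat_div.comp hd hg2)
  exact hF.of_eq fun p => (ratNumDenCode_mkRat_sub p.1 p.2.1 p.2.2).symm

end RatCoding

/-- **Discharge of `IsElementaryReal.isComputableReal`.** Every elementary real is computable.
Tent–Ziegler 2010, §2: the elementary functions are the third Grzegorczyk class `𝓔³` (pp. 43–44),
hence primitive recursive (`ElementaryRec.primrec_holds`) and computable; an `F`-real (Def. 2.4,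
p. 45) for `F` = elementary is therefore a computable real in the sense of Weihrauch 2000,
Def. 4.1.13, after passing to the subsequence `n = 2^k` (so that `1/(2^k + 1) ≤ 2⁻ᵏ`). The
computability of the rational sequence `k ↦ (a (2^k) - b (2^k)) / (c (2^k) + 1)` for Mathlib's
`Primcodable ℚ` is `primrec_rat_of_numDenCode` with `ratNumDenCode_mkRat_sub_primrec`.
[cite: TentZiegler2010, §2 Def. 2.4] -/
theorem IsElementaryReal.isComputableReal_holds : IsElementaryReal.isComputableReal := by
  intro x hx
  obtain ⟨a, b, c, ha, hb, hc, hx⟩ := hx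
  have ha' : Primrec a := Primrec.nat_iff.2 (ElementaryRec.primrec_holds ha)
  have hb' : Primrec b := Primrec.nat_iff.2 (ElementaryRec.primrec_holds hb)
  have hc' : Primrec c := Primrec.nat_iff.2 (ElementaryRec.primrec_holds hc)
  have hpow : Primrec fun k : ℕ => 2 ^ k :=
    (Primrec₂.unpaired'.1 Nat.Primrec.pow).comp (Primrec.const 2) Primrec.id
  refine ⟨fun k => mkRat ((a (2 ^ k) : ℤ) - b (2 ^ k)) (c (2 ^ k) + 1), ?_, ?_⟩
  · refine Primrec.to_comp (primrec_rat_of_numDenCode ?_)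
    exact (ratNumDenCode_mkRat_sub_primrec.comp
      (Primrec.pair (ha'.comp hpow) (Primrec.pair (hb'.comp hpow) (hc'.comp hpow)))).of_eq
        fun k => rfl
  · intro k
    have hcast : ((mkRat ((a (2 ^ k) : ℤ) - b (2 ^ k)) (c (2 ^ k) + 1) : ℚ) : ℝ) =
        ((a (2 ^ k) : ℝ) - b (2 ^ k)) / ((c (2 ^ k) : ℝ) + 1) := by
      rw [Rat.mkRat_eq_div]; push_cast; rfl
    rw [hcast]
    refine (hx (2 ^ k)).trans ?_
    rw [one_div_pow, Nat.cast_pow, Nat.cast_ofNat]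
    exact one_div_le_one_div_of_le (pow_pos two_pos k) (le_add_of_nonneg_right zero_le_one)

/-! ### Discharge of `IsComputableReal.neg` (Weihrauch 2000, Thm. 4.3.2.3) -/

section RatCodingOut

/-! #### Maps out of `ℚ`: numerator, denominator and negation are primitive recursive -/

/-- Counting the members of a Boolean predicate below `n` is monotone in `n`. [folklore] -/
theorem countP_range_mono (p : ℕ → Bool) {m n : ℕ} (h : m ≤ n) :
    (List.range m).countP p ≤ (List.range n).countP p :=
  List.Sublist.countP_le (List.range_sublist.2 h)

/-- Counting the members of a Boolean predicate below `m + 1` when `p m` holds adds one.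
[folklore] -/
theorem countP_range_succ_of_pos (p : ℕ → Bool) {m : ℕ} (hm : p m = true) :
    (List.range (m + 1)).countP p = (List.range m).countP p + 1 := by
  rw [List.range_succ, List.countP_append]
  simp [hm]

/-- Mathlib's code of a rational (for `Primcodable ℚ`: the rank of the numerator–denominator code,
`rat_encode_eq_rank`) is strictly monotone in the numerator–denominator code. [folklore] -/
theorem rat_encode_lt_of_numDenCode_lt {q q' : ℚ}
    (h : Nat.pair (Equiv.intEquivNat q.num) q.den < Nat.pair (Equiv.intEquivNat q'.num) q'.den) :
    @encode ℚ (Primcodable.ofDenumerable ℚ).toEncodable q <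
      @encode ℚ (Primcodable.ofDenumerable ℚ).toEncodable q' := by
  letI := @Encodable.decidableRangeEncode ℚ Rat.instEncodable
  rw [rat_encode_eq_rank, rat_encode_eq_rank]
  have hq : decide (Nat.pair (Equiv.intEquivNat q.num) q.den ∈
      Set.range (@encode ℚ Rat.instEncodable)) = true :=
    decide_eq_true ⟨q, rfl⟩
  calc _ < _ + 1 := Nat.lt_succ_self _
    _ = _ := (countP_range_succ_of_pos _ hq).symm
    _ ≤ _ := countP_range_mono _ h

/-- The numerator–denominator code of a natural number `j`, as a rational, is `Nat.pair (2 j) 1`.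
[folklore] -/
theorem ratNumDenCode_natCast (j : ℕ) :
    Nat.pair (Equiv.intEquivNat (j : ℚ).num) (j : ℚ).den = Nat.pair (2 * j) 1 := by
  rw [Rat.num_natCast, Rat.den_natCast, intEquivNat_natCast]

/-- `j` is at most Mathlib's code of `(j : ℚ)`: the codes of `0, 1, 2, …` are strictly increasing
(`rat_encode_lt_of_numDenCode_lt`, `ratNumDenCode_natCast`). [folklore] -/
theorem self_le_rat_encode_natCast (j : ℕ) :
    j ≤ @encode ℚ (Primcodable.ofDenumerable ℚ).toEncodable (j : ℚ) := by
  induction j with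
  | zero => exact Nat.zero_le _
  | succ j ih =>
    refine Nat.succ_le_of_lt (lt_of_le_of_lt ih (rat_encode_lt_of_numDenCode_lt ?_))
    rw [ratNumDenCode_natCast, ratNumDenCode_natCast]
    exact Nat.pair_lt_pair_left 1 (by omega)

/-- The numerator–denominator code of `q` is at most `Nat.pair (2 c) 1`, where `c` is Mathlib's code
of `q`: otherwise the code of `q` would exceed that of `(c : ℚ)`, whose Mathlib code is at least `c`
(`self_le_rat_encode_natCast`). [folklore] -/
theorem ratNumDenCode_le_pair_encode (q : ℚ) :
    Nat.pair (Equiv.intEquivNat q.num) q.den ≤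
      Nat.pair (2 * @encode ℚ (Primcodable.ofDenumerable ℚ).toEncodable q) 1 := by
  by_contra h
  rw [not_le, ← ratNumDenCode_natCast] at h
  have h1 := rat_encode_lt_of_numDenCode_lt h
  have h2 := self_le_rat_encode_natCast (@encode ℚ (Primcodable.ofDenumerable ℚ).toEncodable q)
  exact absurd h1 (not_lt.2 h2)

/-- The rank function of Mathlib's coding of `ℚ` (the number of numerator–denominator codes below
`n`, cf. `rat_encode_eq_rank`) is primitive recursive: a bounded count of the primitive recursive
predicate `mem_range_ratNumDenCode_primrec`. [folklore] -/
theorem rank_ratNumDenCode_primrec :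
    Primrec fun n : ℕ => (List.range n).countP fun y =>
      @decide (y ∈ Set.range (@encode ℚ Rat.instEncodable))
        (@Encodable.decidableRangeEncode ℚ Rat.instEncodable y) := by
  letI := @Encodable.decidableRangeEncode ℚ Rat.instEncodable
  refine (Primrec.list_length.comp
    ((Primrec.listFilter mem_range_ratNumDenCode_primrec).comp Primrec.list_range)).of_eq ?_
  intro n
  exact List.countP_eq_length_filter.symm

/-- **The numerator–denominator code is primitive recursive on `ℚ`** (for Mathlib's
`Primcodable ℚ`), so that maps *out of* `ℚ` through numerator and denominator are primitive
recursive. Proof by `Primrec.of_graph`: the code of `q` is bounded by `Nat.pair (2 c) 1` with `c`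
the Mathlib code of `q` (`ratNumDenCode_le_pair_encode`), and `m` is the code of `q` iff `m` lies
in the (primitive recursive, `mem_range_ratNumDenCode_primrec`) range of the code and its rank
(`rank_ratNumDenCode_primrec`) is the Mathlib code of `q` (`rat_encode_eq_rank`). This is the
effective retraction `ι : ℚ → ℤ × ℕ` onto lowest terms of Tent–Ziegler 2010, §2 (p. 44), for
Mathlib's codes. [folklore] -/
theorem ratNumDenCode_primrec :
    Primrec fun q : ℚ => Nat.pair (Equiv.intEquivNat q.num) q.den := by
  refine Primrec.of_graph
    ⟨fun q => Nat.pair (2 * @encode ℚ (Primcodable.ofDenumerable ℚ).toEncodable q) 1, ?_,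
      fun q => ?_⟩ ?_
  · exact Primrec₂.natPair.comp (Primrec.nat_double.comp Primrec.encode) (Primrec.const 1)
  · exact ratNumDenCode_le_pair_encode q
  · refine PrimrecPred.of_eq ((mem_range_ratNumDenCode_primrec.comp Primrec.snd).and
        (Primrec.eq.comp (rank_ratNumDenCode_primrec.comp Primrec.snd)
          (Primrec.encode.comp Primrec.fst))) ?_
    rintro ⟨q, m⟩
    dsimp only
    constructor
    · rintro ⟨⟨q', hq'⟩, hrk⟩
      have hqq : @encode ℚ (Primcodable.ofDenumerable ℚ).toEncodable q' =
          @encode ℚ (Primcodable.ofDenumerable ℚ).toEncodable q := by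
        rw [rat_encode_eq_rank q', ← hrk, ← hq']
        rfl
      have : q' = q := @encode_injective ℚ (Primcodable.ofDenumerable ℚ).toEncodable _ _ hqq
      subst this
      exact hq'
    · rintro rfl
      exact ⟨⟨q, rfl⟩, (rat_encode_eq_rank q).symm⟩

/-- `Rat.num : ℚ → ℤ` is primitive recursive (for Mathlib's `Primcodable ℚ` and `Primcodable ℤ`):
the first component of the numerator–denominator code is the `Equiv.intEquivNat` code of the
numerator. [folklore] -/
theorem rat_num_primrec : Primrec Rat.num := by
  refine ((Primrec.ofNat ℤ).comp
    (Primrec.fst.comp (Primrec.unpair.comp ratNumDenCode_primrec))).of_eq fun q => ?_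
  show Denumerable.ofNat ℤ (Nat.unpair (Nat.pair (Equiv.intEquivNat q.num) q.den)).1 = q.num
  rw [Nat.unpair_pair]
  exact Denumerable.ofNat_encode q.num

/-- `Rat.den : ℚ → ℕ` is primitive recursive (for Mathlib's `Primcodable ℚ`): the second component
of the numerator–denominator code. [folklore] -/
theorem rat_den_primrec : Primrec Rat.den := by
  refine (Primrec.snd.comp (Primrec.unpair.comp ratNumDenCode_primrec)).of_eq fun q => ?_
  show (Nat.unpair (Nat.pair (Equiv.intEquivNat q.num) q.den)).2 = q.den
  rw [Nat.unpair_pair]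

/-- Negation on `ℤ` read off from the `Equiv.intEquivNat` code (even codes `2m` are `m`, odd codes
`2m + 1` are `-(m+1)`): the code of `-z` is `c + 1` if the code `c` of `z` is odd and `c - 1`
(truncated, so `0 ↦ 0`) if it is even. [folklore] -/
theorem intEquivNat_neg (z : ℤ) :
    Equiv.intEquivNat (-z) = cond (Equiv.intEquivNat z).bodd (Equiv.intEquivNat z + 1)
      (Equiv.intEquivNat z - 1) := by
  rcases z with (_ | m) | m
  · rfl
  · rw [show Int.ofNat (m + 1) = ((m + 1 : ℕ) : ℤ) from rfl,
      show -(((m + 1 : ℕ) : ℤ)) = Int.negSucc m from rfl, intEquivNat_natCast, intEquivNat_negSucc]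
    simp [Nat.bodd_mul]
    omega
  · rw [show -Int.negSucc m = ((m + 1 : ℕ) : ℤ) from rfl, intEquivNat_natCast, intEquivNat_negSucc]
    simp [Nat.bodd_mul]
    omega

/-- Negation `ℤ → ℤ` is primitive recursive (for Mathlib's `Primcodable ℤ`, whose code is
`Equiv.intEquivNat`), by the parity formula `intEquivNat_neg`. [folklore] -/
theorem int_neg_primrec : Primrec (Neg.neg : ℤ → ℤ) := by
  have h1 : Primrec fun i : ℕ => cond i.bodd (i + 1) (i - 1) :=
    Primrec.cond Primrec.nat_bodd Primrec.succ (Primrec.nat_sub.comp Primrec.id (Primrec.const 1))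
  refine Primrec.encode_iff.1 ((h1.comp Primrec.encode).of_eq fun z => ?_)
  exact (intEquivNat_neg z).symm

/-- **Negation `ℚ → ℚ` is primitive recursive** (for Mathlib's `Primcodable ℚ`): its
numerator–denominator code is `(num, den) ↦ (-num, den)` (`Rat.num_neg_eq_neg_num`,
`Rat.den_neg_eq_den`), primitive recursive by `rat_num_primrec`, `rat_den_primrec` and
`int_neg_primrec`, and `primrec_rat_of_numDenCode` reassembles the rational. This is the "computable
word function `f` with `-ν_ℚ(w) = ν_ℚ f(w)`" of the printed proof of Weihrauch 2000, Thm. 4.3.2.3,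
for Mathlib's notation of `ℚ`. [cite: Weihrauch2000, Thm. 4.3.2.3 (proof)] -/
theorem rat_neg_primrec : Primrec (Neg.neg : ℚ → ℚ) := by
  refine primrec_rat_of_numDenCode ?_
  refine (Primrec₂.natPair.comp
    (Primrec.encode.comp (int_neg_primrec.comp rat_num_primrec)) rat_den_primrec).of_eq fun q => ?_
  rw [Rat.num_neg_eq_neg_num, Rat.den_neg_eq_den]
  rfl

end RatCodingOut

/-- **Discharge of `IsComputableReal.neg`.** The computable reals are closed under negation.
Weihrauch, *Computable Analysis* (2000), Thm. 4.3.2.3: `x ↦ -x` is a computable real function; its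
printed proof negates a Cauchy name termwise through a computable word function `f` with
`-ν_ℚ(w) = ν_ℚ f(w)` ("obviously `ρ_C(q) = -x` if `ρ_C(p) = x`"). With Lemma 4.2.1.3 (computable
reals are those with a computable `g`, `|x - ν_ℚ g(n)| ≤ 2⁻ⁿ`, i.e. the vendored
`IsComputableReal`) and Thm. 2.1.13 / 3.1.6 (computable functions map computable elements to
computable elements) this is the vendored statement. Lean proof, following the printed one: if
`f : ℕ → ℚ` is a computable fast Cauchy name of `x`, then `n ↦ -f n` is computable
(`rat_neg_primrec`, negation on Mathlib's coded `ℚ`) and is a fast Cauchy name of `-x`, since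
`|-x - (-f n)| = |x - f n| ≤ 2⁻ⁿ`. [cite: Weihrauch2000, Thm. 4.3.2.3 with Lemma 4.2.1.3] -/
theorem IsComputableReal.neg_holds : IsComputableReal.neg := by
  intro x hx
  obtain ⟨f, hf, hfx⟩ := hx
  refine ⟨fun n => -f n, rat_neg_primrec.to_comp.comp hf, fun n => ?_⟩
  rw [Rat.cast_neg, show -x - -((f n : ℚ) : ℝ) = -(x - f n) by ring, abs_neg]
  exact hfx n


/-! ### Discharge of `isComputableReal_iff_modulus` (Weihrauch 2000, Lemma 4.2.1, 3 ⇔ 5) -/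

/-- `2⁻ⁿ ≤ 1/(n+1)` in `ℝ`, i.e. `n + 1 ≤ 2ⁿ` (`Nat.lt_two_pow_self`). [folklore] -/
theorem one_half_pow_le_one_div_succ (n : ℕ) : (1 / 2 : ℝ) ^ n ≤ 1 / ((n : ℝ) + 1) := by
  have hpos : (0 : ℝ) < (n : ℝ) + 1 := Nat.cast_add_one_pos n
  have hle : (n : ℝ) + 1 ≤ 2 ^ n := by exact_mod_cast Nat.lt_two_pow_self
  rw [one_div_pow]
  exact one_div_le_one_div_of_le hpos hle

/-- `1/(2ⁿ+1) ≤ 2⁻ⁿ` in `ℝ`. [folklore] -/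
theorem one_div_two_pow_succ_le_one_half_pow (n : ℕ) :
    1 / (((2 ^ n : ℕ) : ℝ) + 1) ≤ (1 / 2 : ℝ) ^ n := by
  rw [one_div_pow, Nat.cast_pow, Nat.cast_ofNat]
  exact one_div_le_one_div_of_le (pow_pos two_pos n) (le_add_of_nonneg_right zero_le_one)

/-- `n ↦ 2⁻ⁿ` is antitone in `ℝ`. [folklore] -/
theorem one_half_pow_antitone {n k : ℕ} (h : n ≤ k) : (1 / 2 : ℝ) ^ k ≤ (1 / 2 : ℝ) ^ n := by
  rw [one_div_pow, one_div_pow]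
  exact one_div_le_one_div_of_le (pow_pos two_pos n) (pow_le_pow_right₀ one_le_two h)

/-- **Discharge of `isComputableReal_iff_modulus`.** A real number `x` is computable (it has a
computable fast Cauchy name `f : ℕ → ℚ`, `|x - f n| ≤ 2⁻ⁿ`; Weihrauch 2000, Lemma 4.2.1.3) iff there
are a computable rational sequence `f` and a computable modulus `m : ℕ → ℕ` with
`|x - f k| ≤ 1/(n+1)` for all `k ≥ m n` (Weihrauch 2000, Lemma 4.2.1.5 with Def. 4.2.2 and the
remark following it; the modulus form is the notion of recursive real number of Rice 1954).
Proof as printed for Lemma 4.2.1, `3 ⟹ 5`: "Define `e(N) := N`" — here `m := id`, using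
`2⁻ᵏ ≤ 2⁻ⁿ ≤ 1/(n+1)` for `k ≥ n`; and `5 ⟹ 3`: reindex the sequence along the modulus — here
`n ↦ f (m (2ⁿ))`, computable as a composition of computable maps (`n ↦ 2ⁿ` by `Nat.Primrec.pow`),
with `|x - f (m (2ⁿ))| ≤ 1/(2ⁿ+1) ≤ 2⁻ⁿ`.
[cite: Weihrauch2000, Lemma 4.2.1 (3 ⇔ 5) and Def. 4.2.2] [cite: Rice1954] -/
theorem isComputableReal_iff_modulus_holds : isComputableReal_iff_modulus := by
  intro x
  constructor
  · rintro ⟨f, hf, hfx⟩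
    refine ⟨f, id, hf, Computable.id, fun n k hk => ?_⟩
    calc |x - f k| ≤ (1 / 2 : ℝ) ^ k := hfx k
      _ ≤ (1 / 2 : ℝ) ^ n := one_half_pow_antitone hk
      _ ≤ 1 / ((n : ℝ) + 1) := one_half_pow_le_one_div_succ n
  · rintro ⟨f, m, hf, hm, hfm⟩
    have hpow : Primrec fun n : ℕ => 2 ^ n :=
      (Primrec₂.unpaired'.1 Nat.Primrec.pow).comp (Primrec.const 2) Primrec.id
    refine ⟨fun n => f (m (2 ^ n)), hf.comp (hm.comp hpow.to_comp), fun n => ?_⟩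
    calc |x - f (m (2 ^ n))| ≤ 1 / (((2 ^ n : ℕ) : ℝ) + 1) := hfm (2 ^ n) (m (2 ^ n)) le_rfl
      _ ≤ (1 / 2 : ℝ) ^ n := one_div_two_pow_succ_le_one_half_pow n

/-! ### Rational arithmetic is primitive recursive; the computable reals form a ring -/

section RatArith

/-- `Int.toNat` read off from the `Equiv.intEquivNat` code: even codes `2m` are `m ↦ m`, odd codes
are negative integers `↦ 0`. [folklore] -/
theorem toNat_eq_cond_intEquivNat (z : ℤ) :
    z.toNat = cond (Equiv.intEquivNat z).bodd 0 (Equiv.intEquivNat z).div2 := by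
  rcases z with m | m
  · rw [show Int.ofNat m = ((m : ℕ) : ℤ) from rfl, intEquivNat_natCast]
    simp [Nat.bodd_mul, Nat.div2_val]
  · rw [intEquivNat_negSucc]
    simp [Nat.bodd_mul]

/-- `Int.toNat : ℤ → ℕ` is primitive recursive (for Mathlib's `Primcodable ℤ`). [folklore] -/
theorem int_toNat_primrec : Primrec Int.toNat := by
  have h1 : Primrec fun i : ℕ => cond i.bodd 0 i.div2 :=
    Primrec.cond Primrec.nat_bodd (Primrec.const 0) Primrec.nat_div2
  refine (h1.comp Primrec.encode).of_eq fun z => ?_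
  have : (encode z) = Equiv.intEquivNat z := rfl
  rw [this, ← toNat_eq_cond_intEquivNat]

/-- The rational `(a - b) / (c + 1)` is a primitive recursive function of `(a, b, c) : ℕ × ℕ × ℕ`
(for Mathlib's `Primcodable ℚ`). [folklore] -/
theorem primrec_mkRat_natSub :
    Primrec fun p : ℕ × ℕ × ℕ => mkRat ((p.1 : ℤ) - p.2.1) (p.2.2 + 1) :=
  primrec_rat_of_numDenCode ratNumDenCode_mkRat_sub_primrec

/-- The positive part of the numerator, `q ↦ q.num.toNat`, is primitive recursive on `ℚ`.
[folklore] -/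
theorem rat_numToNat_primrec : Primrec fun q : ℚ => q.num.toNat :=
  int_toNat_primrec.comp rat_num_primrec

/-- The negative part of the numerator, `q ↦ (-q.num).toNat`, is primitive recursive on `ℚ`.
[folklore] -/
theorem rat_negNumToNat_primrec : Primrec fun q : ℚ => (-q.num).toNat :=
  int_toNat_primrec.comp (int_neg_primrec.comp rat_num_primrec)

/-- Reassembling a rational from naturals: if `z = a - b` in `ℤ` and `d = c + 1` then
`mkRat z d = mkRat (a - b) (c + 1)`; used with `a = z⁺`, `b = z⁻`, `c = d - 1`. [folklore] -/
theorem mkRat_eq_mkRat_natSub (z : ℤ) {d : ℕ} (hd : 0 < d) :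
    mkRat z d = mkRat ((z.toNat : ℤ) - (-z).toNat) ((d - 1) + 1) := by
  rw [Int.toNat_sub_toNat_neg, Nat.sub_add_cancel hd]

/-- **Addition on `ℚ` is primitive recursive** (for Mathlib's `Primcodable ℚ`):
`a + b = mkRat (a.num b.den + b.num a.den) (a.den b.den)`, and splitting numerators into positive
and negative parts writes this as `mkRat (A - B) (C + 1)` with `A B C : ℕ` primitive recursive in
`(a, b)`. [folklore] -/
theorem rat_add_primrec : Primrec₂ ((· + ·) : ℚ → ℚ → ℚ) := by
  have hn1 : Primrec fun p : ℚ × ℚ => p.1.num.toNat := rat_numToNat_primrec.comp Primrec.fst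
  have hm1 : Primrec fun p : ℚ × ℚ => (-p.1.num).toNat := rat_negNumToNat_primrec.comp Primrec.fst
  have hn2 : Primrec fun p : ℚ × ℚ => p.2.num.toNat := rat_numToNat_primrec.comp Primrec.snd
  have hm2 : Primrec fun p : ℚ × ℚ => (-p.2.num).toNat := rat_negNumToNat_primrec.comp Primrec.snd
  have hd1 : Primrec fun p : ℚ × ℚ => p.1.den := rat_den_primrec.comp Primrec.fst
  have hd2 : Primrec fun p : ℚ × ℚ => p.2.den := rat_den_primrec.comp Primrec.snd
  have hA : Primrec fun p : ℚ × ℚ => p.1.num.toNat * p.2.den + p.2.num.toNat * p.1.den :=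
    Primrec.nat_add.comp (Primrec.nat_mul.comp hn1 hd2) (Primrec.nat_mul.comp hn2 hd1)
  have hB : Primrec fun p : ℚ × ℚ => (-p.1.num).toNat * p.2.den + (-p.2.num).toNat * p.1.den :=
    Primrec.nat_add.comp (Primrec.nat_mul.comp hm1 hd2) (Primrec.nat_mul.comp hm2 hd1)
  have hC : Primrec fun p : ℚ × ℚ => p.1.den * p.2.den - 1 :=
    Primrec.nat_sub.comp (Primrec.nat_mul.comp hd1 hd2) (Primrec.const 1)
  have h := primrec_mkRat_natSub.comp (Primrec.pair hA (Primrec.pair hB hC))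
  refine Primrec₂.of_eq (show Primrec₂ fun a b : ℚ => mkRat
      (((a.num.toNat * b.den + b.num.toNat * a.den : ℕ) : ℤ) -
        ((-a.num).toNat * b.den + (-b.num).toNat * a.den : ℕ))
      ((a.den * b.den - 1) + 1) from h) fun a b => ?_
  rw [Rat.add_def', mkRat_eq_mkRat_natSub _ (Nat.mul_pos a.den_pos b.den_pos)]
  congr 1
  have ha := a.num.toNat_sub_toNat_neg
  have hb := b.num.toNat_sub_toNat_neg
  push_cast
  -- both sides are the positive/negative-part split of `a.num * b.den + b.num * a.den`
  have key : (a.num * b.den + b.num * a.den : ℤ) =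
      ((a.num.toNat : ℤ) * b.den + (b.num.toNat : ℤ) * a.den) -
        (((-a.num).toNat : ℤ) * b.den + ((-b.num).toNat : ℤ) * a.den) := by
    conv_lhs => rw [← ha, ← hb]
    ring
  rw [key, Int.toNat_sub_toNat_neg]

/-- **Multiplication on `ℚ` is primitive recursive** (for Mathlib's `Primcodable ℚ`):
`a * b = mkRat (a.num b.num) (a.den b.den)`, with the numerator split into positive and
negative parts. [folklore] -/
theorem rat_mul_primrec : Primrec₂ ((· * ·) : ℚ → ℚ → ℚ) := by
  have hn1 : Primrec fun p : ℚ × ℚ => p.1.num.toNat := rat_numToNat_primrec.comp Primrec.fst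
  have hm1 : Primrec fun p : ℚ × ℚ => (-p.1.num).toNat := rat_negNumToNat_primrec.comp Primrec.fst
  have hn2 : Primrec fun p : ℚ × ℚ => p.2.num.toNat := rat_numToNat_primrec.comp Primrec.snd
  have hm2 : Primrec fun p : ℚ × ℚ => (-p.2.num).toNat := rat_negNumToNat_primrec.comp Primrec.snd
  have hd1 : Primrec fun p : ℚ × ℚ => p.1.den := rat_den_primrec.comp Primrec.fst
  have hd2 : Primrec fun p : ℚ × ℚ => p.2.den := rat_den_primrec.comp Primrec.snd
  have hA : Primrec fun p : ℚ × ℚ =>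
      p.1.num.toNat * p.2.num.toNat + (-p.1.num).toNat * (-p.2.num).toNat :=
    Primrec.nat_add.comp (Primrec.nat_mul.comp hn1 hn2) (Primrec.nat_mul.comp hm1 hm2)
  have hB : Primrec fun p : ℚ × ℚ =>
      p.1.num.toNat * (-p.2.num).toNat + (-p.1.num).toNat * p.2.num.toNat :=
    Primrec.nat_add.comp (Primrec.nat_mul.comp hn1 hm2) (Primrec.nat_mul.comp hm1 hn2)
  have hC : Primrec fun p : ℚ × ℚ => p.1.den * p.2.den - 1 :=
    Primrec.nat_sub.comp (Primrec.nat_mul.comp hd1 hd2) (Primrec.const 1)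
  have h := primrec_mkRat_natSub.comp (Primrec.pair hA (Primrec.pair hB hC))
  refine Primrec₂.of_eq (show Primrec₂ fun a b : ℚ => mkRat
      (((a.num.toNat * b.num.toNat + (-a.num).toNat * (-b.num).toNat : ℕ) : ℤ) -
        ((a.num.toNat * (-b.num).toNat + (-a.num).toNat * b.num.toNat : ℕ)))
      ((a.den * b.den - 1) + 1) from h) fun a b => ?_
  rw [Rat.mul_def', mkRat_eq_mkRat_natSub _ (Nat.mul_pos a.den_pos b.den_pos)]
  congr 1
  have ha := a.num.toNat_sub_toNat_neg
  have hb := b.num.toNat_sub_toNat_neg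
  push_cast
  have key : (a.num * b.num : ℤ) =
      ((a.num.toNat : ℤ) * b.num.toNat + ((-a.num).toNat : ℤ) * (-b.num).toNat) -
        ((a.num.toNat : ℤ) * (-b.num).toNat + ((-a.num).toNat : ℤ) * b.num.toNat) := by
    conv_lhs => rw [← ha, ← hb]
    ring
  rw [key, Int.toNat_sub_toNat_neg]

/-- Subtraction on `ℚ` is primitive recursive. [folklore] -/
theorem rat_sub_primrec : Primrec₂ ((· - ·) : ℚ → ℚ → ℚ) :=
  (rat_add_primrec.comp Primrec.fst (rat_neg_primrec.comp Primrec.snd)).of_eq fun p => by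
    simp [sub_eq_add_neg]

/-- Nonnegativity `0 ≤ q` is a primitive recursive predicate on `ℚ` (`0 ≤ q ↔ (-q.num)⁺ = 0`).
[folklore] -/
theorem rat_nonneg_primrecPred : PrimrecPred fun q : ℚ => 0 ≤ q := by
  refine PrimrecPred.of_eq (Primrec.eq.comp rat_negNumToNat_primrec (Primrec.const 0)) fun q => ?_
  rw [Int.toNat_eq_zero, neg_nonpos, Rat.num_nonneg]

/-- The order `≤` on `ℚ` is a primitive recursive relation. [folklore] -/
theorem rat_le_primrecRel : PrimrecRel ((· ≤ ·) : ℚ → ℚ → Prop) := by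
  change PrimrecPred fun p : ℚ × ℚ => p.1 ≤ p.2
  refine PrimrecPred.of_eq (rat_nonneg_primrecPred.comp (rat_sub_primrec.comp Primrec.snd Primrec.fst))
    fun p => ?_
  simp only [sub_nonneg]

/-- The strict order `<` on `ℚ` is a primitive recursive relation. [folklore] -/
theorem rat_lt_primrecRel : PrimrecRel ((· < ·) : ℚ → ℚ → Prop) := by
  change PrimrecPred fun p : ℚ × ℚ => p.1 < p.2
  refine PrimrecPred.of_eq (PrimrecPred.not (rat_le_primrecRel.comp Primrec.snd Primrec.fst))
    fun p => ?_
  simp only [not_le]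

/-- The cast `ℕ → ℚ` is primitive recursive. [folklore] -/
theorem rat_natCast_primrec : Primrec (fun n : ℕ => (n : ℚ)) := by
  refine (primrec_mkRat_natSub.comp
    (Primrec.pair Primrec.id (Primrec.pair (Primrec.const 0) (Primrec.const 0)))).of_eq fun n => ?_
  simp [Rat.mkRat_eq_div]

/-- The dyadic rationals `(a, k) ↦ a / 2 ^ k` are a primitive recursive function of `(a, k) : ℕ × ℕ`.
[folklore] -/
theorem rat_natDivTwoPow_primrec : Primrec₂ (fun a k : ℕ => (a : ℚ) / 2 ^ k) := by
  have hpow : Primrec fun k : ℕ => 2 ^ k :=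
    (Primrec₂.unpaired'.1 Nat.Primrec.pow).comp (Primrec.const 2) Primrec.id
  refine (primrec_mkRat_natSub.comp (Primrec.pair Primrec.fst (Primrec.pair (Primrec.const 0)
    (Primrec.nat_sub.comp (hpow.comp Primrec.snd) (Primrec.const 1))))).of_eq fun p => ?_
  have h1 : 2 ^ p.2 - 1 + 1 = 2 ^ p.2 := Nat.sub_add_cancel Nat.one_le_two_pow
  simp only [Nat.cast_zero, sub_zero, h1, Rat.mkRat_eq_div]
  push_cast
  rfl

end RatArith

/-! ### Discharges of `IsComputableReal.add` and `IsComputableReal.mul` (Weihrauch 2000, Thm. 4.3.2) -/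

/-- **Discharge of `IsComputableReal.add`.** Computable reals are closed under addition
(Weihrauch, *Computable Analysis* (2000), Thm. 4.3.2.4 with Lemma 4.2.1.3): if `f`, `g` are
computable fast Cauchy names of `x`, `y`, then `n ↦ f (n+1) + g (n+1)` is a computable
(`rat_add_primrec`) fast Cauchy name of `x + y`, since `2⁻⁽ⁿ⁺¹⁾ + 2⁻⁽ⁿ⁺¹⁾ = 2⁻ⁿ`.
[cite: Weihrauch2000, Thm. 4.3.2] -/
theorem IsComputableReal.add_holds : IsComputableReal.add := by
  intro x y hx hy
  obtain ⟨f, hf, hfx⟩ := hx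
  obtain ⟨g, hg, hgy⟩ := hy
  refine ⟨fun n => f (n + 1) + g (n + 1),
    rat_add_primrec.to_comp.comp (hf.comp Computable.succ) (hg.comp Computable.succ), fun n => ?_⟩
  have h1 := hfx (n + 1)
  have h2 := hgy (n + 1)
  rw [Rat.cast_add]
  calc |x + y - ((f (n + 1) : ℝ) + g (n + 1))| = |(x - f (n + 1)) + (y - g (n + 1))| := by ring_nf
    _ ≤ |x - f (n + 1)| + |y - g (n + 1)| := abs_add_le _ _
    _ ≤ (1 / 2 : ℝ) ^ (n + 1) + (1 / 2 : ℝ) ^ (n + 1) := add_le_add h1 h2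
    _ = (1 / 2 : ℝ) ^ n := by ring

/-- A fast Cauchy name stays within `1` of its limit: `|f n| ≤ |x| + 1`. [folklore] -/
theorem abs_cast_le_of_fastCauchy {x : ℝ} {f : ℕ → ℚ} (hfx : ∀ n, |x - f n| ≤ (1 / 2 : ℝ) ^ n)
    (n : ℕ) : |(f n : ℝ)| ≤ |x| + 1 := by
  have h := hfx n
  have hle : (1 / 2 : ℝ) ^ n ≤ 1 := pow_le_one₀ (by norm_num) (by norm_num)
  calc |(f n : ℝ)| = |x - (x - f n)| := by ring_nf
    _ ≤ |x| + |x - f n| := abs_sub _ _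
    _ ≤ |x| + 1 := by linarith

/-- **Discharge of `IsComputableReal.mul`.** Computable reals are closed under multiplication
(Weihrauch, *Computable Analysis* (2000), Thm. 4.3.2.5 with Lemma 4.2.1.3): if `f`, `g` are
computable fast Cauchy names of `x`, `y` and `|x| + |y| + 1 ≤ 2^s`, then `n ↦ f (n+s) * g (n+s)` is a
computable (`rat_mul_primrec`) fast Cauchy name of `x y`, since
`|xy - f g| ≤ |x| |y - g| + |g| |x - f| ≤ (|x| + |y| + 1) 2⁻⁽ⁿ⁺ˢ⁾ ≤ 2⁻ⁿ`.
[cite: Weihrauch2000, Thm. 4.3.2] -/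
theorem IsComputableReal.mul_holds : IsComputableReal.mul := by
  intro x y hx hy
  obtain ⟨f, hf, hfx⟩ := hx
  obtain ⟨g, hg, hgy⟩ := hy
  obtain ⟨s, hs⟩ : ∃ s : ℕ, |x| + |y| + 1 ≤ 2 ^ s := by
    obtain ⟨s, hs⟩ := pow_unbounded_of_one_lt (|x| + |y| + 1) (by norm_num : (1 : ℝ) < 2)
    exact ⟨s, hs.le⟩
  have hshift : Computable fun n : ℕ => n + s :=
    (Primrec.nat_add.comp Primrec.id (Primrec.const s)).to_comp
  refine ⟨fun n => f (n + s) * g (n + s),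
    rat_mul_primrec.to_comp.comp (hf.comp hshift) (hg.comp hshift), fun n => ?_⟩
  have h1 := hfx (n + s)
  have h2 := hgy (n + s)
  have hgb : |(g (n + s) : ℝ)| ≤ |y| + 1 := abs_cast_le_of_fastCauchy hgy (n + s)
  have hpos : (0 : ℝ) ≤ (1 / 2 : ℝ) ^ (n + s) := pow_nonneg (by norm_num) _
  rw [Rat.cast_mul]
  calc |x * y - (f (n + s) : ℝ) * g (n + s)|
        = |x * (y - g (n + s)) + (g (n + s) : ℝ) * (x - f (n + s))| := by ring_nf
    _ ≤ |x * (y - g (n + s))| + |(g (n + s) : ℝ) * (x - f (n + s))| := abs_add_le _ _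
    _ = |x| * |y - g (n + s)| + |(g (n + s) : ℝ)| * |x - f (n + s)| := by
          rw [abs_mul, abs_mul]
    _ ≤ |x| * (1 / 2 : ℝ) ^ (n + s) + (|y| + 1) * (1 / 2 : ℝ) ^ (n + s) := by
          gcongr
    _ = (|x| + |y| + 1) * ((1 / 2 : ℝ) ^ n * (1 / 2 : ℝ) ^ s) := by rw [pow_add]; ring
    _ ≤ 2 ^ s * ((1 / 2 : ℝ) ^ n * (1 / 2 : ℝ) ^ s) := by gcongr
    _ = (1 / 2 : ℝ) ^ n := by
          rw [one_div_pow (2 : ℝ) s]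
          field_simp

/-- Computable reals are closed under subtraction (from `add_holds` and `neg_holds`).
[cite: Weihrauch2000, Thm. 4.3.2] -/
theorem IsComputableReal.sub {x y : ℝ} (hx : IsComputableReal x) (hy : IsComputableReal y) :
    IsComputableReal (x - y) := by
  simpa [sub_eq_add_neg] using IsComputableReal.add_holds hx (IsComputableReal.neg_holds hy)

/-- Natural numbers are computable reals. [cite: Weihrauch2000, Example 4.1.4] -/
theorem IsComputableReal.natCast (n : ℕ) : IsComputableReal (n : ℝ) := by
  simpa using IsComputableReal.ratCast_holds (n : ℚ)

/-- **The computable reals form a subring of `ℝ`** (Weihrauch 2000, Cor. 4.3.4: the computable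
real numbers are a real closed field; here only the ring structure). [cite: Weihrauch2000, Thm. 4.3.2] -/
theorem exists_subring_coe_eq_computableReals : ∃ S : Subring ℝ, (S : Set ℝ) = computableReals :=
  ⟨{ carrier := computableReals
     mul_mem' := fun ha hb => IsComputableReal.mul_holds ha hb
     one_mem' := by simpa using IsComputableReal.ratCast_holds 1
     add_mem' := fun ha hb => IsComputableReal.add_holds ha hb
     zero_mem' := by simpa using IsComputableReal.ratCast_holds 0
     neg_mem' := fun ha => IsComputableReal.neg_holds ha }, rfl⟩

/-- The subring of `ℝ` generated by a set of computable reals consists of computable reals.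
[cite: Weihrauch2000, Thm. 4.3.2] -/
theorem subringClosure_subset_computableReals {s : Set ℝ} (hs : s ⊆ computableReals) :
    (Subring.closure s : Set ℝ) ⊆ computableReals := by
  obtain ⟨S, hS⟩ := exists_subring_coe_eq_computableReals
  rw [← hS] at hs ⊢
  exact Subring.closure_le.2 hs

/-! ### Computable reals from computable two-sided rational approximations -/

/-- **Two-sided approximation principle.** If `lo, hi : ℕ → ℚ` are computable with
`lo j ≤ x ≤ hi j` for all `j` and gaps `hi j - lo j` becoming `≤ 2⁻ⁿ` for some `j = j(n)` (no rate
required), then `x` is a computable real: the least such `j` is found by unbounded search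
(`Nat.rfind`), which terminates, and `n ↦ lo (j n)` is a computable fast Cauchy name. This is the
passage from "decidable lower and upper rational bounds converging to `x`" to a computable Cauchy
name (Weihrauch 2000, Lemma 4.2.1; Rice 1954). [cite: Weihrauch2000, Lemma 4.2.1] -/
theorem IsComputableReal.of_twoSided {x : ℝ} (lo hi : ℕ → ℚ) (hlo : Computable lo)
    (hhi : Computable hi) (h1 : ∀ j, (lo j : ℝ) ≤ x) (h2 : ∀ j, x ≤ hi j)
    (h3 : ∀ n : ℕ, ∃ j, hi j - lo j ≤ 1 / (2 : ℚ) ^ n) : IsComputableReal x := by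
  classical
  -- the test `hi j - lo j ≤ 2⁻ⁿ` is computable in `(n, j)`
  set c : ℕ → ℕ → Bool := fun n j => decide (hi j - lo j ≤ 1 / (2 : ℚ) ^ n) with hc
  have hbound : Primrec fun n : ℕ => 1 / (2 : ℚ) ^ n := by
    simpa using rat_natDivTwoPow_primrec.comp (Primrec.const 1) Primrec.id
  have hc_comp : Computable₂ c := by
    have hgap : Computable fun p : ℕ × ℕ => hi p.2 - lo p.2 :=
      rat_sub_primrec.to_comp.comp (hhi.comp Computable.snd) (hlo.comp Computable.snd)
    have hle : Computable₂ fun a b : ℚ => decide (a ≤ b) :=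
      (PrimrecRel.decide rat_le_primrecRel).to_comp
    exact (hle.comp hgap (hbound.to_comp.comp Computable.fst)).of_eq fun p => rfl
  -- the search terminates
  have hdom : ∀ n, (Nat.rfind fun j => Part.some (c n j)).Dom := by
    intro n
    rw [Nat.rfind_dom]
    obtain ⟨j, hj⟩ := h3 n
    refine ⟨j, ?_, fun _ => trivial⟩
    rw [Part.mem_some_iff]
    exact (decide_eq_true hj).symm
  set J : ℕ → ℕ := fun n => (Nat.rfind fun j => Part.some (c n j)).get (hdom n) with hJ
  have hJ_comp : Computable J := by
    have hr : Partrec fun n => Nat.rfind fun j => Part.some (c n j) :=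
      Partrec.rfind hc_comp.partrec₂
    refine Partrec.of_eq hr fun n => ?_
    exact Part.eq_some_iff.2 (Part.get_mem (hdom n))
  have hJ_spec : ∀ n, hi (J n) - lo (J n) ≤ 1 / (2 : ℚ) ^ n := by
    intro n
    have hm : true ∈ Part.some (c n (J n)) := Nat.rfind_spec (Part.get_mem (hdom n))
    simp only [Part.mem_some_iff] at hm
    simpa [hc] using hm.symm
  refine ⟨fun n => lo (J n), hlo.comp hJ_comp, fun n => ?_⟩
  have hlo' := h1 (J n)
  have hhi' := h2 (J n)
  have hgap : ((hi (J n) : ℚ) : ℝ) - lo (J n) ≤ (1 / 2 : ℝ) ^ n := by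
    have h' : (((hi (J n) - lo (J n) : ℚ)) : ℝ) ≤ (((1 / (2 : ℚ) ^ n : ℚ)) : ℝ) :=
      Rat.cast_le.2 (hJ_spec n)
    rw [Rat.cast_sub, Rat.cast_div, Rat.cast_one, Rat.cast_pow, Rat.cast_ofNat] at h'
    rwa [one_div_pow]
  show |x - (lo (J n) : ℝ)| ≤ (1 / 2 : ℝ) ^ n
  rw [abs_of_nonneg (by linarith)]
  linarith

end Literature.Computability.Complexity
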